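import Summits.CriticalPhenomena.PercolationContinuityZ3.Theorems.PercNearOneGluingNoHeavyLowerTailOneCutFourBlobsLinear
import Summits.CriticalPhenomena.PercolationContinuityZ3.Theorems.PercNearOneGluingNoHeavyLowerTailLonelyRelay
import HarnessLib

/-!
# The one-cut bound for ANY number of blobs when every pair of blobs is heavy

Support file for the crux `NoHeavyLowerTail` (stmt-CriticalPhenomena-4575; routes `PercNearOneGluing`,
`PercNearOneGluingNoHeavy`), BLOB-QUOTIENT analysis of the one-cut engine (depth prover nh-dp-blobmono),
continuing `…OneCutThreeBlobs.lean`, `…OneCutFourBlobs.lean`, `…OneCutFourBlobsLinear.lean`.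

Setting: `μ = prodBernoulli w` on `Fin n`, relays `A`, observer `o`, `N = |{a ∈ A : o ↔ a}|`,
`E N = Σ_{a∈A} μ(o ↔ a)`, minority event `B = {1 ≤ N < E N/2}`, a blob structure `cls : Fin n → Fin b` on
`insert o A` (same label ⇒ joined almost surely) with ANY number `b` of labels, masses `m_i = |A ∩ cls⁻¹ i|`,
and a TRANSVERSAL `R ⊆ A` of the non-observer blobs (one relay per non-observer label that occurs).

On the good set the minority event is `{N ≥ 1} ∩ {m_{cls o} + m(S) < E N/2}` (`S` = blobs reached); the light
sets `S` form a down-set.  This file settles the regime in which that down-set has RANK ≤ 1, i.e. every PAIR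
of non-observer blobs is heavy:

* `oneCut_of_blobs_allPairsHeavy_transversal` — `R` a transversal of all relay blobs (e.g. no relay in the
  observer's blob and `R` a transversal of the others) and `m_r + m_{r'} ≥ E N/2` for distinct `r, r' ∈ R`: then `B ⊆ {exactly one element of R is joined to o}` up to
  a null set, and the LONELY-RELAY LEMMA `Theorems.lonelyRelay_of_pairs` (prim-cplus-engine; Kozma–Nitzan
  Lemma 2 / BHK terminal separation) gives the bound with constant `1`, for every `b` and `|A|`.
* `oneCut_of_blobs_allPairsHeavy` — the observer's blob carries a relay `x₀` and some `|R| ≥ 3` relays from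
  distinct non-observer blobs satisfy `m_{cls o} + m_r + m_{r'} ≥ E N/2` pairwise (no transversal needed):
  then `B ⊆ {x₀ misses at least |R| − 1 elements of R}` and the layer-cake inequality
  `(k−1)·μ{at least k−1 of k events} ≤ Σ μ(event)` (`measureReal_layerCake_card`) gives the bound with
  constant `|R|/(|R|−1) ≤ 3/2`.  (Two pairwise-heavy blobs plus the observer's is the heavy-blob/three-blob
  situation: constant `1` by `oneCut_of_blobs_heavy` / `oneCut_of_threeBlobs`.)

Consequence for the planners: a counterexample to the one-cut bound with constant `3/2` on a blob structure
needs a LIGHT PAIR of blobs (two blobs jointly below the threshold) — the "many small blobs" regime, which by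
the four-blob analysis is Kozma–Nitzan gluing with `b − 2` relays.
-/

noncomputable section

namespace Summit.CriticalPhenomena.PercolationContinuityZ3.Theorems

open MeasureTheory Set Literature.Probability.LatticeModels Literature.Probability.Percolation
open scoped Classical BigOperators

variable {n : ℕ}

/-- **Layer cake for counting events.**  For a finite family of events `D r`, `r ∈ R`, and `k : ℕ`:
`k · μ{ω : at least k of the events hold} ≤ Σ_{r∈R} μ(D r)`. [folklore] -/
theorem measureReal_layerCake_card (w : Sym2 (Fin n) → unitInterval) (R : Finset (Fin n))
    (D : Fin n → Set (BondConfig (Fin n))) (k : ℕ) :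
    (k : ℝ) * (prodBernoulli w).real {ω : BondConfig (Fin n) | k ≤ (R.filter fun r => ω ∈ D r).card} ≤
      ∑ r ∈ R, (prodBernoulli w).real (D r) := by
  set μ := prodBernoulli w with hμ
  set E := {ω : BondConfig (Fin n) | k ≤ (R.filter fun r => ω ∈ D r).card} with hE
  have hsum : ∑ r ∈ R, μ.real (D r) = ∫ ω, (∑ r ∈ R, (D r).indicator (1 : BondConfig (Fin n) → ℝ) ω) ∂μ := by
    rw [integral_finsetSum R fun r _ => Integrable.of_finite]
    refine Finset.sum_congr rfl fun r _ => ?_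
    rw [integral_indicator_one MeasurableSet.of_discrete]
  have hE' : (k : ℝ) * μ.real E = ∫ ω, E.indicator (fun _ => (k : ℝ)) ω ∂μ := by
    rw [integral_indicator_const _ MeasurableSet.of_discrete, smul_eq_mul, mul_comm]
  rw [hsum, hE']
  refine integral_mono Integrable.of_finite Integrable.of_finite fun ω => ?_
  have hcount : (∑ r ∈ R, (D r).indicator (1 : BondConfig (Fin n) → ℝ) ω) =
      ((R.filter fun r => ω ∈ D r).card : ℝ) := by
    rw [Finset.natCast_card_filter]
    refine Finset.sum_congr rfl fun r _ => ?_
    simp only [Set.indicator_apply, Pi.one_apply]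
  rw [hcount]
  by_cases h : ω ∈ E
  · rw [Set.indicator_of_mem h]
    have h' : k ≤ (R.filter fun r => ω ∈ D r).card := h
    show ((k : ℕ) : ℝ) ≤ (((R.filter fun r => ω ∈ D r).card : ℕ) : ℝ)
    exact_mod_cast h'
  · rw [Set.indicator_of_notMem h]
    exact Nat.cast_nonneg _

/-- **All pairs heavy, full transversal (any number of blobs): constant 1.**  Blob structure
`cls : Fin n → Fin b` on `insert o A`, a transversal `R ⊆ A` of ALL relay blobs (one relay per label occurring
in `A`; if the observer's blob carries relays, `R` contains one of them), and every pair of distinct members of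
`R` heavy (`m_{cls r} + m_{cls r'} ≥ E N/2`).  Then the one-cut bound holds with constant `1`: the minority
event forces exactly one member of `R` to be joined to `o`, and `Theorems.lonelyRelay_of_pairs` bounds that.
Typical use: the observer's blob carries no relay (then `R` is a transversal of the non-observer blobs).
[folklore] -/
theorem oneCut_of_blobs_allPairsHeavy_transversal {b : ℕ} (w : Sym2 (Fin n) → unitInterval)
    (A : Finset (Fin n)) (o : Fin n) (t : ℝ) (cls : Fin n → Fin b)
    (hcls : ∀ u ∈ insert o A, ∀ v ∈ insert o A, cls u = cls v →
      (prodBernoulli w).real (openConn u v)ᶜ = 0)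
    (R : Finset (Fin n)) (hRA : R ⊆ A)
    (hRinj : ∀ r ∈ R, ∀ r' ∈ R, cls r = cls r' → r = r')
    (hRcov : ∀ a ∈ A, ∃ r ∈ R, cls r = cls a)
    (hheavy : ∀ r ∈ R, ∀ r' ∈ R, r ≠ r' →
      (∑ a ∈ A, (prodBernoulli w).real (openConn o a)) / 2 ≤
        ((A.filter fun a => cls a = cls r).card : ℝ) + ((A.filter fun a => cls a = cls r').card : ℝ))
    (ht : 0 ≤ t)
    (hpair : ∀ a ∈ A, ∀ a' ∈ A, a ≠ a' → (prodBernoulli w).real (openConn a a')ᶜ ≤ t) :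
    (prodBernoulli w).real {ω : BondConfig (Fin n) |
        1 ≤ (A.filter fun a => ω ∈ openConn o a).card ∧
        ((A.filter fun a => ω ∈ openConn o a).card : ℝ) <
          (∑ a ∈ A, (prodBernoulli w).real (openConn o a)) / 2} ≤ t := by
  set μ := prodBernoulli w with hμ
  set EN := ∑ a ∈ A, μ.real (openConn o a) with hEN
  have hENle : EN ≤ (A.card : ℝ) := expectedCount_le_card w A o
  by_cases hR2 : 2 ≤ R.card
  · -- trap: exactly one member of `R` is joined to `o`
    refine oneCut_of_blobs_trap w A o t cls hcls _
      {ω : BondConfig (Fin n) | (R.filter fun r => ω ∈ openConn o r).card = 1} (fun ω hω => ?_)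
      (lonelyRelay_of_pairs n w R o t hR2 ht fun a ha a' ha' hne => hpair a (hRA ha) a' (hRA ha') hne)
    obtain ⟨⟨h1, hNlt⟩, hωG⟩ := hω
    show (R.filter fun r => ω ∈ openConn o r).card = 1
    -- at least one member of `R` is reached
    obtain ⟨d, hd⟩ := Finset.card_pos.1 h1
    obtain ⟨hdA, hod⟩ := Finset.mem_filter.1 hd
    obtain ⟨r, hr, hcr⟩ := hRcov d hdA
    have hor : (openGraph ω).Reachable o r :=
      hod.trans (hωG d (Finset.mem_insert_of_mem hdA) r (Finset.mem_insert_of_mem (hRA hr)) hcr.symm)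
    have hpos : 0 < (R.filter fun r => ω ∈ openConn o r).card :=
      Finset.card_pos.2 ⟨r, Finset.mem_filter.2 ⟨hr, hor⟩⟩
    -- no two members of `R` are reached
    have hle : (R.filter fun r => ω ∈ openConn o r).card ≤ 1 := by
      by_contra hgt
      push Not at hgt
      obtain ⟨y, hy, z, hz, hyz⟩ := Finset.one_lt_card.1 hgt
      obtain ⟨hyR, hoy⟩ := Finset.mem_filter.1 hy
      obtain ⟨hzR, hoz⟩ := Finset.mem_filter.1 hz
      have hcyz : cls y ≠ cls z := fun h => hyz (hRinj y hyR z hzR h)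
      have hge := blobs_count_ge_two A o cls ω hωG (hRA hyR) (hRA hzR) hoy hoz hcyz
      have hge' : ((A.filter fun a => cls a = cls y).card : ℝ) + ((A.filter fun a => cls a = cls z).card : ℝ) ≤
          ((A.filter fun a => ω ∈ openConn o a).card : ℝ) := by exact_mod_cast hge
      have := hheavy y hyR z hzR hyz
      linarith
    omega
  · -- at most one non-observer blob: the minority event is empty on the good set
    push Not at hR2
    refine oneCut_of_blobs_trap w A o t cls hcls _ ∅ (fun ω hω => ?_) (by rw [measureReal_empty]; exact ht)
    obtain ⟨⟨h1, hNlt⟩, hωG⟩ := hω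
    obtain ⟨d, hd⟩ := Finset.card_pos.1 h1
    obtain ⟨hdA, hod⟩ := Finset.mem_filter.1 hd
    obtain ⟨r, hr, hcr⟩ := hRcov d hdA
    -- every relay carries the label of `r`
    have hall : ∀ a ∈ A, cls a = cls r := by
      intro a ha
      obtain ⟨r', hr', hcr'⟩ := hRcov a ha
      have : r' = r := by
        by_contra hne
        have : 1 < R.card := Finset.one_lt_card.2 ⟨r', hr', r, hr, hne⟩
        omega
      rw [← hcr', this]
    have hor : (openGraph ω).Reachable o r :=
      hod.trans (hωG d (Finset.mem_insert_of_mem hdA) r (Finset.mem_insert_of_mem (hRA hr)) hcr.symm)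
    have hge := blobs_count_ge_one A o cls ω hωG (hRA hr) hor
    have hfull : (A.filter fun a => cls a = cls r) = A := Finset.filter_true_of_mem hall
    rw [hfull] at hge
    have hge' : (A.card : ℝ) ≤ ((A.filter fun a => ω ∈ openConn o a).card : ℝ) := by exact_mod_cast hge
    have h1' : (1 : ℝ) ≤ ((A.filter fun a => ω ∈ openConn o a).card : ℝ) := by exact_mod_cast h1
    exact absurd (show False by linarith) id

/-- **All pairs heavy, observer blob with a relay (any number of blobs): constant `|R|/(|R|−1) ≤ 3/2`.**
Blob structure `cls : Fin n → Fin b` on `insert o A`, a relay `x₀` in the observer's blob, a transversal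
`R ⊆ A` of the non-observer blobs with `|R| ≥ 3`, and every pair of distinct members of `R` heavy together with
the observer's blob (`m_{cls o} + m_{cls r} + m_{cls r'} ≥ E N/2`).  Then `μ(B) ≤ (3/2)·t`: the minority event
forces `x₀` to miss at least `|R| − 1` members of `R`, and the layer cake bounds that by
`Σ_r μ{x₀ ↮ r}/(|R|−1) ≤ |R| t/(|R|−1)`. [folklore] -/
theorem oneCut_of_blobs_allPairsHeavy {b : ℕ} (w : Sym2 (Fin n) → unitInterval)
    (A : Finset (Fin n)) (o : Fin n) (t : ℝ) (cls : Fin n → Fin b)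
    (hcls : ∀ u ∈ insert o A, ∀ v ∈ insert o A, cls u = cls v →
      (prodBernoulli w).real (openConn u v)ᶜ = 0)
    {x₀ : Fin n} (hx₀ : x₀ ∈ A) (hcx₀ : cls x₀ = cls o)
    (R : Finset (Fin n)) (hRA : R ⊆ A) (hRo : ∀ r ∈ R, cls r ≠ cls o)
    (hRinj : ∀ r ∈ R, ∀ r' ∈ R, cls r = cls r' → r = r')
    (hR3 : 3 ≤ R.card)
    (hheavy : ∀ r ∈ R, ∀ r' ∈ R, r ≠ r' →
      (∑ a ∈ A, (prodBernoulli w).real (openConn o a)) / 2 ≤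
        ((A.filter fun a => cls a = cls o).card : ℝ) + ((A.filter fun a => cls a = cls r).card : ℝ) +
          ((A.filter fun a => cls a = cls r').card : ℝ))
    (ht : 0 ≤ t)
    (hpair : ∀ a ∈ A, ∀ a' ∈ A, a ≠ a' → (prodBernoulli w).real (openConn a a')ᶜ ≤ t) :
    (prodBernoulli w).real {ω : BondConfig (Fin n) |
        1 ≤ (A.filter fun a => ω ∈ openConn o a).card ∧
        ((A.filter fun a => ω ∈ openConn o a).card : ℝ) <
          (∑ a ∈ A, (prodBernoulli w).real (openConn o a)) / 2} ≤ 3 / 2 * t := by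
  set μ := prodBernoulli w with hμ
  set EN := ∑ a ∈ A, μ.real (openConn o a) with hEN
  set k := R.card with hk
  -- the trap: `x₀` misses at least `k - 1` members of `R`
  set E := {ω : BondConfig (Fin n) | k - 1 ≤ (R.filter fun r => ω ∈ (openConn x₀ r)ᶜ).card} with hE
  have hxr : ∀ r ∈ R, x₀ ≠ r := fun r hr h => hRo r hr (by rw [← h, hcx₀])
  -- layer cake: (k-1) μ(E) ≤ Σ_r μ{x₀ ↮ r} ≤ k t
  have hcake : ((k - 1 : ℕ) : ℝ) * μ.real E ≤ ∑ r ∈ R, μ.real (openConn x₀ r)ᶜ := by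
    have := measureReal_layerCake_card w R (fun r => (openConn x₀ r)ᶜ) (k - 1)
    rw [hE]
    convert this using 8 with ω
  have hsum : ∑ r ∈ R, μ.real (openConn x₀ r)ᶜ ≤ (k : ℝ) * t :=
    calc ∑ r ∈ R, μ.real (openConn x₀ r)ᶜ ≤ ∑ _r ∈ R, t :=
          Finset.sum_le_sum fun r hr => hpair x₀ hx₀ r (hRA hr) (hxr r hr)
      _ = (k : ℝ) * t := by rw [Finset.sum_const, nsmul_eq_mul]
  have hk1 : (2 : ℝ) ≤ ((k - 1 : ℕ) : ℝ) := by
    have : 2 ≤ k - 1 := by omega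
    exact_mod_cast this
  have hkk : (k : ℝ) ≤ 3 / 2 * ((k - 1 : ℕ) : ℝ) := by
    have : (((k - 1 : ℕ) : ℝ)) = (k : ℝ) - 1 := by
      rw [Nat.cast_sub (by omega)]; simp
    rw [this]
    have : (3 : ℝ) ≤ (k : ℝ) := by exact_mod_cast hR3
    linarith
  have hE_le : μ.real E ≤ 3 / 2 * t := by
    have hEnn : 0 ≤ μ.real E := measureReal_nonneg
    have h1 : ((k - 1 : ℕ) : ℝ) * μ.real E ≤ (k : ℝ) * t := hcake.trans hsum
    -- (k-1) μE ≤ k t ≤ (3/2)(k-1) t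
    have h2 : (k : ℝ) * t ≤ 3 / 2 * ((k - 1 : ℕ) : ℝ) * t := by nlinarith
    have h3 : ((k - 1 : ℕ) : ℝ) * μ.real E ≤ ((k - 1 : ℕ) : ℝ) * (3 / 2 * t) := by nlinarith
    exact le_of_mul_le_mul_left h3 (by linarith)
  refine oneCut_of_blobs_trap w A o (3 / 2 * t) cls hcls _ E (fun ω hω => ?_) hE_le
  obtain ⟨⟨h1, hNlt⟩, hωG⟩ := hω
  show k - 1 ≤ (R.filter fun r => ω ∈ (openConn x₀ r)ᶜ).card
  have hox : (openGraph ω).Reachable o x₀ :=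
    hωG o (Finset.mem_insert_self _ _) x₀ (Finset.mem_insert_of_mem hx₀) hcx₀.symm
  -- at most one member of `R` is reached from `o` (hence from `x₀`)
  have hreach : (R.filter fun r => ω ∈ openConn x₀ r).card ≤ 1 := by
    by_contra hgt
    push Not at hgt
    obtain ⟨y, hy, z, hz, hyz⟩ := Finset.one_lt_card.1 hgt
    obtain ⟨hyR, hxy⟩ := Finset.mem_filter.1 hy
    obtain ⟨hzR, hxz⟩ := Finset.mem_filter.1 hz
    have hoy : (openGraph ω).Reachable o y := hox.trans hxy
    have hoz : (openGraph ω).Reachable o z := hox.trans hxz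
    have hcyz : cls y ≠ cls z := fun h => hyz (hRinj y hyR z hzR h)
    have hge := blobs_count_ge_three A o cls ω hωG (hRA hyR) (hRA hzR) hoy hoz (hRo y hyR) (hRo z hzR) hcyz
    have hge' : ((A.filter fun a => cls a = cls o).card : ℝ) + ((A.filter fun a => cls a = cls y).card : ℝ) +
        ((A.filter fun a => cls a = cls z).card : ℝ) ≤ ((A.filter fun a => ω ∈ openConn o a).card : ℝ) := by
      exact_mod_cast hge
    have := hheavy y hyR z hzR hyz
    linarith
  -- complement count inside `R`
  have hsplit := Finset.card_filter_add_card_filter_not (s := R) (fun r => ω ∈ openConn x₀ r)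
  have hcc : (R.filter fun r => ¬ ω ∈ openConn x₀ r) = (R.filter fun r => ω ∈ (openConn x₀ r)ᶜ) := rfl
  rw [hcc] at hsplit
  omega

/-! ## Transversals exist; corollaries with the blob structure alone -/

/-- Every blob structure admits a transversal of the relay blobs: a set `R ⊆ A` with pairwise distinct labels
meeting every label that occurs in `A` (take the least relay of each label). [folklore] -/
theorem exists_blob_transversal {b : ℕ} (A : Finset (Fin n)) (cls : Fin n → Fin b) :
    ∃ R : Finset (Fin n), R ⊆ A ∧ (∀ r ∈ R, ∀ r' ∈ R, cls r = cls r' → r = r') ∧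
      (∀ a ∈ A, ∃ r ∈ R, cls r = cls a) := by
  refine ⟨A.filter fun a => ∀ a' ∈ A, cls a' = cls a → a ≤ a', Finset.filter_subset _ _, ?_, ?_⟩
  · intro r hr r' hr' h
    obtain ⟨hrA, hrmin⟩ := Finset.mem_filter.1 hr
    obtain ⟨hr'A, hr'min⟩ := Finset.mem_filter.1 hr'
    exact le_antisymm (hrmin r' hr'A h.symm) (hr'min r hrA h)
  · intro a ha
    set F := A.filter fun a' => cls a' = cls a with hF
    have hne : F.Nonempty := ⟨a, Finset.mem_filter.2 ⟨ha, rfl⟩⟩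
    have hmem := Finset.mem_filter.1 (Finset.min'_mem F hne)
    refine ⟨F.min' hne, Finset.mem_filter.2 ⟨hmem.1, fun a' ha' h => ?_⟩, hmem.2⟩
    exact Finset.min'_le F a' (Finset.mem_filter.2 ⟨ha', h.trans hmem.2⟩)

/-- **All pairs heavy, observer-free, blob structure alone (any number of blobs): constant 1.**  No relay
in the observer's blob and `m_{cls y} + m_{cls z} ≥ E N/2` for all relays `y, z` of different blobs ⇒ the
one-cut bound with constant `1` (via a transversal and `oneCut_of_blobs_allPairsHeavy_transversal`).
[folklore] -/
theorem oneCut_of_blobs_allPairsHeavy_observerFree {b : ℕ} (w : Sym2 (Fin n) → unitInterval)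
    (A : Finset (Fin n)) (o : Fin n) (t : ℝ) (cls : Fin n → Fin b)
    (hcls : ∀ u ∈ insert o A, ∀ v ∈ insert o A, cls u = cls v →
      (prodBernoulli w).real (openConn u v)ᶜ = 0)
    (hheavy : ∀ y ∈ A, ∀ z ∈ A, cls y ≠ cls z →
      (∑ a ∈ A, (prodBernoulli w).real (openConn o a)) / 2 ≤
        ((A.filter fun a => cls a = cls y).card : ℝ) + ((A.filter fun a => cls a = cls z).card : ℝ))
    (ht : 0 ≤ t)
    (hpair : ∀ a ∈ A, ∀ a' ∈ A, a ≠ a' → (prodBernoulli w).real (openConn a a')ᶜ ≤ t) :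
    (prodBernoulli w).real {ω : BondConfig (Fin n) |
        1 ≤ (A.filter fun a => ω ∈ openConn o a).card ∧
        ((A.filter fun a => ω ∈ openConn o a).card : ℝ) <
          (∑ a ∈ A, (prodBernoulli w).real (openConn o a)) / 2} ≤ t := by
  obtain ⟨R, hRA, hRinj, hRcov⟩ := exists_blob_transversal A cls
  exact oneCut_of_blobs_allPairsHeavy_transversal w A o t cls hcls R hRA hRinj hRcov
    (fun r hr r' hr' hne => hheavy r (hRA hr) r' (hRA hr') fun h => hne (hRinj r hr r' hr' h)) ht hpair

/-- **Three pairwise-heavy blobs besides an observer blob with a relay, blob structure alone: constant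
`3/2`.**  A relay `x₀` in the observer's blob and three relays `y, z, u` of pairwise distinct non-observer
blobs whose pairs are heavy together with the observer's blob ⇒ `μ(B) ≤ (3/2)·t`
(via `oneCut_of_blobs_allPairsHeavy` with `R = {y, z, u}`). [folklore] -/
theorem oneCut_of_blobs_threeHeavyPairs {b : ℕ} (w : Sym2 (Fin n) → unitInterval)
    (A : Finset (Fin n)) (o : Fin n) (t : ℝ) (cls : Fin n → Fin b)
    (hcls : ∀ u ∈ insert o A, ∀ v ∈ insert o A, cls u = cls v →
      (prodBernoulli w).real (openConn u v)ᶜ = 0)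
    {x₀ y z u : Fin n} (hx₀ : x₀ ∈ A) (hcx₀ : cls x₀ = cls o) (hy : y ∈ A) (hz : z ∈ A) (hu : u ∈ A)
    (hyo : cls y ≠ cls o) (hzo : cls z ≠ cls o) (huo : cls u ≠ cls o)
    (hyz : cls y ≠ cls z) (hyu : cls y ≠ cls u) (hzu : cls z ≠ cls u)
    (hheavy : ∀ r ∈ ({y, z, u} : Finset (Fin n)), ∀ r' ∈ ({y, z, u} : Finset (Fin n)), r ≠ r' →
      (∑ a ∈ A, (prodBernoulli w).real (openConn o a)) / 2 ≤
        ((A.filter fun a => cls a = cls o).card : ℝ) + ((A.filter fun a => cls a = cls r).card : ℝ) +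
          ((A.filter fun a => cls a = cls r').card : ℝ))
    (ht : 0 ≤ t)
    (hpair : ∀ a ∈ A, ∀ a' ∈ A, a ≠ a' → (prodBernoulli w).real (openConn a a')ᶜ ≤ t) :
    (prodBernoulli w).real {ω : BondConfig (Fin n) |
        1 ≤ (A.filter fun a => ω ∈ openConn o a).card ∧
        ((A.filter fun a => ω ∈ openConn o a).card : ℝ) <
          (∑ a ∈ A, (prodBernoulli w).real (openConn o a)) / 2} ≤ 3 / 2 * t := by
  have hyz' : y ≠ z := fun h => hyz (by rw [h])
  have hyu' : y ≠ u := fun h => hyu (by rw [h])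
  have hzu' : z ≠ u := fun h => hzu (by rw [h])
  refine oneCut_of_blobs_allPairsHeavy w A o t cls hcls hx₀ hcx₀ {y, z, u} ?_ ?_ ?_ ?_ hheavy ht hpair
  · intro r hr
    simp only [Finset.mem_insert, Finset.mem_singleton] at hr
    rcases hr with rfl | rfl | rfl
    · exact hy
    · exact hz
    · exact hu
  · intro r hr
    simp only [Finset.mem_insert, Finset.mem_singleton] at hr
    rcases hr with rfl | rfl | rfl
    · exact hyo
    · exact hzo
    · exact huo
  · intro r hr r' hr' h
    simp only [Finset.mem_insert, Finset.mem_singleton] at hr hr'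
    rcases hr with rfl | rfl | rfl <;> rcases hr' with rfl | rfl | rfl <;>
      first | rfl | exact absurd h ‹_› | exact absurd h.symm ‹_›
  · rw [Finset.card_insert_of_notMem (by simp [hyz', hyu']), Finset.card_insert_of_notMem (by simp [hzu']),
      Finset.card_singleton]

end Summit.CriticalPhenomena.PercolationContinuityZ3.Theorems

end
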